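import Summits.CriticalPhenomena.CardyFormulaZ2.Theorems.CardyBoundaryCoulombGasBoundaryDefectGaussianRStubRealisabilityPart23
import Literature.Probability.LatticeModels.CollarLegModelStrandsExpansion

/-!
# Stub `stub_realisability` of line `rainbow-monomials-in-excursion-kernels` — Part 26:
# strand ends of the collar walk (V): coded target edges, live targets, and the turns at the
# ghost of a rail dart in the completed configuration of `∅`
# (crux `BoundaryDefectGaussianR`, stmt-CriticalPhenomena-14132; insertion dictionary D2, layer 3b)

Towards hypotheses (E2)/(E3) of the rainbow forcing `s14_rainbow_of_valid` (Part 18) for the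
registered ends `ι.strandEnds V` (Parts 26/27; Parts 20–23: rail geometry, active darts, tags,
pairs). A CUT is `CollarLegModel.IsCut M c`: the target of `c` is not live and the turn at the
end of `c` is not a consistent tracked turn for the prescribed data (zero configuration, completed
configuration `M.cfgOf ∅` of no live edge).

* general `M`: the corner `(v, k)` (site `toSite v`) arrives at the lattice edge at `v` in
  direction `k + 1`; as a CODED edge `e` (`cIn e` / `cOut e`) its endpoints are `v`, `v + dir (k+1)`
  (`se_corner_edge`); the target is live iff both are in `V` (`se_targetsLive_iff`), present in
  `cfgOf ω` iff `e ∈ ω` or `e` is frozen open (`se_cTgt_mem_cfgOf_iff`); a frozen open edge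
  with an endpoint in `V` has an arc endpoint (`se_openEdges_arc`), one with no endpoint in `V`
  is an edge of a pocket (`se_openEdges_outside`); a face with no corner in `V` is not a
  face-cell (`se_not_mem_faceCells`);
* at an active rail dart `ds[t] = (c, K)` of an admissible flat insertion, ghost `g = c + dir K`:
  the two faces at `g` away from the rail are not face-cells (`se_ghost_outer_faces`), so **the
  outer corner `(g, K)` is a cut** (`se_isCut_ghost_out`); a frozen open edge at `g` lying outside
  `V` is an edge of the pocket after `ds[t]` or after the previous dart (`se_ghost_edge_open`), so
  **`(g, K)` turns to `(g, K + 1)` in `cfgOf ∅` when the stretch after `ds[t]` is free**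
  (`se_next_ghost_out`); on a wired stretch `c` is an arc vertex and `g` a ghost
  (`se_arc_and_ghost`), and at a junction closing the arc the arc vertex `c` is prescribed at the
  wired level (`se_arc_vertH`).

Registered one-line form: `s14_strandEnds_cornerEdge`. All [folklore].
-/

namespace Summit.CriticalPhenomena.CardyFormulaZ2.Cruxes.BoundaryDefectGaussianR.RainbowMonomialsInExcursionKernels

open Literature.Probability.LatticeModels Literature.Probability.LatticeModels.CollarLegModel

/-! ### Corners, coded edges, live targets, the completed configuration of `∅` -/

/-- Unit steps in `Site 2`: `toSite (v + dir k) = toSite v + cornerUnit k`. [folklore] -/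
theorem se_toSite_add_dir (v : ℤ × ℤ) (k : Fin 4) : toSite (v + dir k) = toSite v + cornerUnit k := by
  rw [toSite_add_cornerUnit]
  obtain ⟨p, q⟩ := v
  fin_cases k <;> simp [tp_dir_val, sub_eq_add_neg]

/-- **The coded edge at the end of a corner.** The corner `(v, k)` arrives at the lattice edge at
`v` in direction `k + 1`; as a coded edge `e` (`cIn e` or `cOut e`) its endpoints are `v` and
`v + dir (k+1)`. [folklore] -/
theorem se_corner_edge (v : ℤ × ℤ) (k : Fin 4) : ∃ e : (ℤ × ℤ) × Bool,
    ((toSite v, k) = cIn e ∨ (toSite v, k) = cOut e) ∧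
    ((e.1 = v ∧ SixVertex.edgeTip e = v + dir (k + 1)) ∨ (e.1 = v + dir (k + 1) ∧ SixVertex.edgeTip e = v)) := by
  obtain ⟨p, q⟩ := v
  fin_cases k
  · exact ⟨((p, q), true), Or.inl rfl, Or.inl ⟨rfl, by simp [SixVertex.edgeTip, tp_dir_val]⟩⟩
  · refine ⟨((p - 1, q), false), Or.inr ?_, Or.inr ⟨by simp [tp_dir_val, sub_eq_add_neg], by simp [SixVertex.edgeTip]⟩⟩
    simp [cOut, SixVertex.edgeTip]
  · refine ⟨((p, q - 1), true), Or.inr ?_, Or.inr ⟨by simp [tp_dir_val, sub_eq_add_neg], by simp [SixVertex.edgeTip]⟩⟩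
    simp [cOut, SixVertex.edgeTip]
  · exact ⟨((p, q), false), Or.inl rfl, Or.inl ⟨rfl, by simp [SixVertex.edgeTip, tp_dir_val]⟩⟩

/-- **Live targets.** The corner `(v, k)` targets a live edge iff `v` and `v + dir (k+1)` are both
vertices of `V`. [folklore] -/
theorem se_targetsLive_iff (M : CollarLegModel) (v : ℤ × ℤ) (k : Fin 4) :
    M.TargetsLive (toSite v, k) ↔ v ∈ M.V ∧ v + dir (k + 1) ∈ M.V := by
  obtain ⟨e, hc, hend⟩ := se_corner_edge v k
  have hE : M.TargetsLive (toSite v, k) ↔ e ∈ M.E := by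
    rcases hc with hc | hc <;> rw [hc]
    · exact M.targetsLive_cIn_iff e
    · exact M.targetsLive_cOut_iff e
  rw [hE, E, inducedEdges, Finset.mem_filter, SixVertex.mem_edges_iff]
  rcases hend with ⟨h1, h2⟩ | ⟨h1, h2⟩ <;> rw [h1, h2] <;> tauto

/-- The target of a corner is present in the completed configuration of `ω` iff its coded edge is
in `ω` or frozen open. [folklore] -/
theorem se_cTgt_mem_cfgOf_iff (M : CollarLegModel) (ω : Finset ((ℤ × ℤ) × Bool)) {v : ℤ × ℤ} {k : Fin 4}
    {e : (ℤ × ℤ) × Bool} (hc : (toSite v, k) = cIn e ∨ (toSite v, k) = cOut e) :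
    cTgt (toSite v, k) ∈ M.cfgOf ω ↔ e ∈ ω ∨ e ∈ M.openEdges := by
  have : cTgt (toSite v, k) = edgeSym2 e := by
    rcases hc with hc | hc <;> rw [hc]
    exacts [cTgt_cIn e, cTgt_cOut e]
  rw [this, M.edgeSym2_mem_cfgOf_iff]

/-- A frozen open edge with an endpoint in `V` is a spoke: one of its endpoints is an arc vertex. [folklore] -/
theorem se_openEdges_arc (M : CollarLegModel) {e : (ℤ × ℤ) × Bool} (ho : e ∈ M.openEdges)
    (hV : e.1 ∈ M.V ∨ SixVertex.edgeTip e ∈ M.V) : e.1 ∈ M.arcVerts ∨ SixVertex.edgeTip e ∈ M.arcVerts := by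
  rw [openEdges, Finset.mem_filter] at ho
  rcases ho.2 with h1 | h1 | h1
  · exact Or.inl h1.1
  · exact Or.inr h1.1
  · exact absurd hV (by tauto)

/-- The endpoints of an edge of a face are corners of the face. [folklore] -/
theorem se_mem_faceEdges_corners {p : ℤ × ℤ} {e : (ℤ × ℤ) × Bool} (h : e ∈ faceEdges p) :
    e.1 ∈ SixVertex.faceCorners p ∧ SixVertex.edgeTip e ∈ SixVertex.faceCorners p := by
  obtain ⟨a, b⟩ := p
  simp only [faceEdges, Finset.mem_insert, Finset.mem_singleton] at h
  rcases h with rfl | rfl | rfl | rfl <;> simp [SixVertex.faceCorners, SixVertex.edgeTip]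

/-- A frozen open edge with no endpoint in `V` is an edge of a pocket, both of its endpoints being
corners of that pocket. [folklore] -/
theorem se_openEdges_outside (M : CollarLegModel) {e : (ℤ × ℤ) × Bool} (ho : e ∈ M.openEdges)
    (h1 : e.1 ∉ M.V) (h2 : SixVertex.edgeTip e ∉ M.V) :
    ∃ p ∈ M.pockets, e.1 ∈ SixVertex.faceCorners p ∧ SixVertex.edgeTip e ∈ SixVertex.faceCorners p := by
  rw [openEdges, Finset.mem_filter] at ho
  rcases ho.2 with h | h | ⟨-, -, p, hp, he⟩
  · exact absurd (Finset.mem_inter.1 h.1).2 h1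
  · exact absurd (Finset.mem_inter.1 h.1).2 h2
  · exact ⟨p, hp, se_mem_faceEdges_corners he⟩

/-- A face at a vertex has that vertex as a corner. [folklore] -/
theorem se_mem_faceCorners_of_mem_vertexFaces {v f : ℤ × ℤ} (h : f ∈ SixVertex.vertexFaces v) :
    v ∈ SixVertex.faceCorners f := by
  obtain ⟨a, b⟩ := v
  simp only [SixVertex.vertexFaces, Finset.mem_insert, Finset.mem_singleton] at h
  rcases h with rfl | rfl | rfl | rfl <;> simp [SixVertex.faceCorners]

/-- A face none of whose corners is in `V` is not a face-cell. [folklore] -/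
theorem se_not_mem_faceCells (M : CollarLegModel) {f : ℤ × ℤ} (h : ∀ v ∈ SixVertex.faceCorners f, v ∉ M.V) :
    f ∉ M.faceCells := by
  intro hf
  rw [faceCells, SixVertex.faces, Finset.mem_biUnion] at hf
  obtain ⟨v, hv, hvf⟩ := hf
  exact h v (se_mem_faceCorners_of_mem_vertexFaces hvf) hv

section Cuts

variable (ι : LegInsertionData) (V : Finset (ℤ × ℤ)) {d₀ : Dart} (hadm : ι.IsAdmissible V)
  (h : outDart V ι.sink = some d₀) {st : ℕ → WalkState}
  (hst : ∀ t, st t = List.foldl (fun s d => s.step (ι.startAt V d)) ι.init ((cycle V d₀).take t))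
  {t : ℕ} (ht : t < (cycle V d₀).length) {c : ℤ × ℤ} {K : Fin 4}
  (hch : ∀ s t : ℤ, -2 ≤ s → s ≤ 2 → -2 ≤ t → t ≤ 2 → (c + s • dir (K + 1) + t • dir K ∈ V ↔ t ≤ 0))
  (hchp : ∀ s t : ℤ, -2 ≤ s → s ≤ 2 → -2 ≤ t → t ≤ 2 →
    (c - dir (K + 1) + s • dir (K + 1) + t • dir K ∈ V ↔ t ≤ 0))
  (hds : (cycle V d₀)[t] = (c, K))
  (hpred1 : ∀ (h1 : 1 ≤ t), (cycle V d₀)[t - 1] = (c - dir (K + 1), K))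
  (hpred0 : t = 0 → (cycle V d₀)[(cycle V d₀).length - 1]'(by omega) = (c - dir (K + 1), K))

include hch in
/-- The two faces at the ghost `c + dir K` away from the rail (those of the corners `(g, K)` and
`(g, K + 3)`) have no corner in `V`: they are not face-cells. [folklore] -/
theorem se_ghost_outer_faces :
    ofSite (cFace (toSite (c + dir K), K)) ∉ (⟨V, ι.collar V⟩ : CollarLegModel).faceCells ∧
      ofSite (cFace (toSite (c + dir K), K + 3)) ∉ (⟨V, ι.collar V⟩ : CollarLegModel).faceCells := by
  obtain ⟨g1, -, g3, -⟩ := se_gapFace_eq_cFace (c + dir K) K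
  have out : ∀ s t : ℤ, -2 ≤ s → s ≤ 2 → 1 ≤ t → t ≤ 2 → c + s • dir (K + 1) + t • dir K ∉ V := by
    intro s t hs1 hs2 ht1 ht2 hm
    have := (hch s t hs1 hs2 (by omega) ht2).1 hm
    omega
  constructor
  · rw [← g1]
    refine se_not_mem_faceCells _ fun v hv => ?_
    rw [se_faceCorners_gapFace] at hv
    simp only [Finset.mem_insert, Finset.mem_singleton] at hv
    rcases hv with rfl | rfl | rfl | rfl
    · have e : c + dir K = c + (0 : ℤ) • dir (K + 1) + (1 : ℤ) • dir K := by module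
      rw [e]; exact out 0 1 (by norm_num) (by norm_num) (by norm_num) (by norm_num)
    · have e : c + dir K + dir (K + 1) = c + (1 : ℤ) • dir (K + 1) + (1 : ℤ) • dir K := by module
      rw [e]; exact out 1 1 (by norm_num) (by norm_num) (by norm_num) (by norm_num)
    · have e : c + dir K + dir K = c + (0 : ℤ) • dir (K + 1) + (2 : ℤ) • dir K := by module
      rw [e]; exact out 0 2 (by norm_num) (by norm_num) (by norm_num) (by norm_num)
    · have e : c + dir K + dir K + dir (K + 1) = c + (1 : ℤ) • dir (K + 1) + (2 : ℤ) • dir K := by module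
      rw [e]; exact out 1 2 (by norm_num) (by norm_num) (by norm_num) (by norm_num)
  · rw [← g3]
    refine se_not_mem_faceCells _ fun v hv => ?_
    rw [se_faceCorners_gapFace] at hv
    simp only [Finset.mem_insert, Finset.mem_singleton] at hv
    rcases hv with rfl | rfl | rfl | rfl
    · have e : c + dir K - dir (K + 1) = c + (-1 : ℤ) • dir (K + 1) + (1 : ℤ) • dir K := by module
      rw [e]; exact out (-1) 1 (by norm_num) (by norm_num) (by norm_num) (by norm_num)
    · have e : c + dir K - dir (K + 1) + dir (K + 1) = c + (0 : ℤ) • dir (K + 1) + (1 : ℤ) • dir K := by module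
      rw [e]; exact out 0 1 (by norm_num) (by norm_num) (by norm_num) (by norm_num)
    · have e : c + dir K - dir (K + 1) + dir K = c + (-1 : ℤ) • dir (K + 1) + (2 : ℤ) • dir K := by module
      rw [e]; exact out (-1) 2 (by norm_num) (by norm_num) (by norm_num) (by norm_num)
    · have e : c + dir K - dir (K + 1) + dir K + dir (K + 1) = c + (0 : ℤ) • dir (K + 1) + (2 : ℤ) • dir K := by module
      rw [e]; exact out 0 2 (by norm_num) (by norm_num) (by norm_num) (by norm_num)

include hch in
/-- **The outer turn at the ghost is a cut**: the corner `(g, K)` at the ghost `g = c + dir K` is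
untracked (its face is outside) and its target is not live. [folklore] -/
theorem se_isCut_ghost_out : (ι.model V).IsCut (toSite (c + dir K), K) := by
  obtain ⟨-, hcK, -⟩ := se_rail_local hch
  refine ⟨fun hl => hcK ((se_targetsLive_iff _ _ _).1 hl).1, fun hcons => ?_⟩
  exact (se_ghost_outer_faces ι V hch).1 hcons.1.2

include hadm h hst ht hch hds hpred1 hpred0 in
/-- **A frozen open edge at the ghost lying outside `V` borders a pocket met at `ds[t]` or at the
previous dart**: if a coded edge with endpoints the ghost `g = c + dir K` and `g' ∉ V` is frozen
open, then either the stretch after `ds[t]` is wired and `g'` is a corner of the gap face after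
`(c, K)`, or the stretch before is wired and `g'` is a corner of the gap face after the previous
rail dart. [folklore] -/
theorem se_ghost_edge_open {e : (ℤ × ℤ) × Bool} (ho : e ∈ (ι.model V).openEdges) {g' : ℤ × ℤ}
    (hend : (e.1 = c + dir K ∧ SixVertex.edgeTip e = g') ∨ (e.1 = g' ∧ SixVertex.edgeTip e = c + dir K))
    (hg' : g' ∉ V) :
    ((st (t + 1)).wired = true ∧ g' ∈ SixVertex.faceCorners (gapFace (c, K))) ∨
      ((st t).wired = true ∧ g' ∈ SixVertex.faceCorners (gapFace (c - dir (K + 1), K))) := by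
  obtain ⟨-, hcK, -⟩ := se_rail_local hch
  have h12 : e.1 ∉ V ∧ SixVertex.edgeTip e ∉ V := by
    rcases hend with ⟨h1, h2⟩ | ⟨h1, h2⟩ <;> rw [h1, h2]
    exacts [⟨hcK, hg'⟩, ⟨hg', hcK⟩]
  obtain ⟨p, hp, hc1, hc2⟩ := se_openEdges_outside _ ho h12.1 h12.2
  have hgp : c + dir K ∈ SixVertex.faceCorners p ∧ g' ∈ SixVertex.faceCorners p := by
    rcases hend with ⟨h1, h2⟩ | ⟨h1, h2⟩
    · rw [h1] at hc1; rw [h2] at hc2; exact ⟨hc1, hc2⟩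
    · rw [h1] at hc1; rw [h2] at hc2; exact ⟨hc2, hc1⟩
  obtain ⟨t', ht', hw', hgap⟩ := (mem_collar_pocket_iff ι V h hst).1 (Finset.mem_inter.1 hp).1
  rw [← hgap] at hgp
  have hext := se_cycle_exterior ι V hadm h ht'
  rcases se_rail_ghostCorner hch hext.1 hext.2 hgp.1 with hd | hd
  · obtain rfl := se_cycle_index_inj ι V hadm h ht' ht (hd.trans hds.symm)
    rw [hd] at hgp
    exact Or.inl ⟨hw', hgp.2⟩
  · obtain ⟨tp, htp, hdsp, -, hwp, -⟩ := se_pred_index ι V hadm h hst ht hpred1 hpred0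
    obtain rfl := se_cycle_index_inj ι V hadm h ht' htp (hd.trans hdsp.symm)
    rw [hd] at hgp
    exact Or.inr ⟨hwp ▸ hw', hgp.2⟩

include hadm h hst ht hch hds hpred1 hpred0 in
/-- **The outer turn at the ghost crosses a closed edge** when the stretch after `ds[t]` is free:
then `nextCorner (cfgOf ∅) (g, K) = (g, K + 1)` (the edge `{g, g + dir (K+1)}` is not a pocket
edge). [folklore] -/
theorem se_next_ghost_out (hw1 : (st (t + 1)).wired = false) :
    nextCorner ((ι.model V).cfgOf ∅) (toSite (c + dir K), K) = (toSite (c + dir K), K + 1) := by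
  apply nextCorner_of_not_mem
  obtain ⟨e, hc, hend⟩ := se_corner_edge (c + dir K) K
  rw [se_cTgt_mem_cfgOf_iff _ _ hc]
  rintro (hm | ho)
  · simp at hm
  have hg' : c + dir K + dir (K + 1) ∉ V := by
    have e1 : c + dir K + dir (K + 1) = c + (1 : ℤ) • dir (K + 1) + (1 : ℤ) • dir K := by module
    rw [e1]; intro hm
    have := (hch 1 1 (by norm_num) (by norm_num) (by norm_num) (by norm_num)).1 hm
    omega
  rcases se_ghost_edge_open ι V hadm h hst ht hch hds hpred1 hpred0 ho hend hg' with ⟨hw, -⟩ | ⟨-, hcor⟩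
  · rw [hw1] at hw; exact Bool.false_ne_true hw
  · rw [se_faceCorners_gapFace] at hcor
    have g0 : c + dir K + dir (K + 1) = c - dir (K + 1) + (2 : ℤ) • dir (K + 1) + (1 : ℤ) • dir K := by module
    have e1 : c - dir (K + 1) = c - dir (K + 1) + (0 : ℤ) • dir (K + 1) + (0 : ℤ) • dir K := by module
    have e2 : c - dir (K + 1) + dir (K + 1) = c - dir (K + 1) + (1 : ℤ) • dir (K + 1) + (0 : ℤ) • dir K := by module
    have e3 : c - dir (K + 1) + dir K = c - dir (K + 1) + (0 : ℤ) • dir (K + 1) + (1 : ℤ) • dir K := by module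
    have e4 : c - dir (K + 1) + dir K + dir (K + 1) = c - dir (K + 1) + (1 : ℤ) • dir (K + 1) + (1 : ℤ) • dir K := by
      module
    simp only [Finset.mem_insert, Finset.mem_singleton] at hcor
    rcases hcor with hq | hq | hq | hq
    · rw [g0] at hq; conv_rhs at hq => rw [e1]
      rw [se_frame_inj] at hq; omega
    · rw [g0, e2, se_frame_inj] at hq; omega
    · rw [g0, e3, se_frame_inj] at hq; omega
    · rw [g0, e4, se_frame_inj] at hq; omega

include h hst ht hch hds in
/-- On a wired stretch the rail point `c` is an arc vertex and `c + dir K` a ghost. [folklore] -/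
theorem se_arc_and_ghost (hw : (st t).wired = true ∨ (st (t + 1)).wired = true) :
    c ∈ (ι.model V).arcVerts ∧ c + dir K ∈ (ι.model V).ghosts := by
  obtain ⟨hcV, hcK, -⟩ := se_rail_local hch
  have harc : c ∈ (ι.collar V).arc := (mem_collar_arc_iff ι V h hst).2 ⟨t, ht, hw, by rw [hds]⟩
  have harcV : c ∈ (ι.model V).arcVerts := Finset.mem_inter.2 ⟨harc, hcV⟩
  refine ⟨harcV, ?_⟩
  rw [ghosts, Finset.mem_sdiff, Finset.mem_union]
  exact ⟨Or.inl (Finset.mem_biUnion.2 ⟨c, harcV, se_ghost_mem_neighbours c K⟩), hcK⟩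

include hadm h hst ht hch hds in
/-- **The arc vertex at a junction closing the arc** (wired before `ds[t]`) is prescribed at the
level before the dart, and it is not a free vertex. [folklore] -/
theorem se_arc_vertH (hw : (st t).wired = true) :
    (c, false) ∉ (ι.model V).freeCells ∧ (ι.collar V).vertH c = (st t).level := by
  obtain ⟨hcV, hcK, -⟩ := se_rail_local hch
  have harc : c ∈ (ι.collar V).arc := (mem_collar_arc_iff ι V h hst).2 ⟨t, ht, Or.inl hw, by rw [hds]⟩
  constructor
  · rw [mem_freeCells_false, freeVerts, Finset.mem_sdiff, not_and, not_not]
    exact fun _ => harc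
  · refine collar_vertH_eq ι V h hst ht ?_ fun t' ht' ℓ' hm' => ?_
    · rw [hds, mention_of_vertex V (x := c) (e := ((c, K), st t, st (t + 1))) (Or.inl hw) (Or.inl rfl)]
      simp [hw]
    · exfalso
      have hne : LegInsertionData.mention V c ((cycle V d₀)[t'], st t', st (t' + 1)) ≠ none := by rw [hm']; simp
      rw [Ne, mention_eq_none_iff] at hne
      have hext := se_cycle_exterior ι V hadm h (t := t') (by omega)
      apply hne
      refine ⟨fun hA => ?_, fun hB => hB.2.2 hcV⟩
      rcases hA.2 with h1 | h1
      · have := se_rail_dart_unique hch h1 hext.2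
        have := se_cycle_index_inj ι V hadm h (by omega) ht (this.trans hds.symm)
        omega
      · exact hext.2 (h1 ▸ hcV)

end Cuts

/-! ### Registered one-line form -/

/-- **Sub-goal `s14_strandEnds_cornerEdge`** (registered on stmt-CriticalPhenomena-14132): the
coded edge at the end of the corner `(v, k)` of a collar leg model — endpoints `v` and
`v + dir (k+1)`, live iff both are vertices of `V`, present in the completed configuration of `ω`
iff in `ω` or frozen open. [folklore] -/
theorem s14_strandEnds_cornerEdge : ∀ (M : Literature.Probability.LatticeModels.CollarLegModel) (ω : Finset ((ℤ × ℤ) × Bool)) (v : ℤ × ℤ) (k : Fin 4), (M.TargetsLive (Literature.Probability.LatticeModels.CollarLegModel.toSite v, k) ↔ v ∈ M.V ∧ v + Literature.Probability.LatticeModels.CollarLegModel.dir (k + 1) ∈ M.V) ∧ ∃ e : (ℤ × ℤ) × Bool, ((Literature.Probability.LatticeModels.CollarLegModel.toSite v, k) = Literature.Probability.LatticeModels.CollarLegModel.cIn e ∨ (Literature.Probability.LatticeModels.CollarLegModel.toSite v, k) = Literature.Probability.LatticeModels.CollarLegModel.cOut e) ∧ ((e.1 = v ∧ Literature.Probability.LatticeModels.SixVertex.edgeTip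 e = v + Literature.Probability.LatticeModels.CollarLegModel.dir (k + 1)) ∨ (e.1 = v + Literature.Probability.LatticeModels.CollarLegModel.dir (k + 1) ∧ Literature.Probability.LatticeModels.SixVertex.edgeTip e = v)) ∧ (Literature.Probability.LatticeModels.cTgt (Literature.Probability.LatticeModels.CollarLegModel.toSite v, k) ∈ M.cfgOf ω ↔ e ∈ ω ∨ e ∈ M.openEdges) := by
  intro M ω v k
  obtain ⟨e, hc, hend⟩ := se_corner_edge v k
  exact ⟨se_targetsLive_iff M v k, e, hc, hend, se_cTgt_mem_cfgOf_iff M ω hc⟩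

end Summit.CriticalPhenomena.CardyFormulaZ2.Cruxes.BoundaryDefectGaussianR.RainbowMonomialsInExcursionKernels
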